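import Mathlib
import Literature.NumberTheory.EllipticCurves.HeegnerPointsImaginaryQuadraticProofs
import HarnessLib

/-!
# A Minkowski unit for a Galois extension of an imaginary quadratic field: the Galois
# conjugates `σε`, `σ ≠ 1`, are multiplicatively independent

Support file 1 of the brick «(b) weak Leopoldt over `𝔎_∞`: `Ē_∞ ↪ U_v`» (cell bsd-print-cf2, LEAD
ruling B23 §4 (b)) for crux `PrintCf2RubinValueTwo.TwoVariableMainConjAtSplitTwo`
(stmt-BirchSwinnertonDyer-23720). Namespace `…Theorems.PrintCf2.LeopoldtAtV`.

Let `K` be an imaginary quadratic field and `F/K` a finite Galois extension with group `G`. Since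
`K` has a single (complex) place, `G` acts simply transitively on the infinite places of `F`
(`smul_infinitePlace_bijective`), and Dirichlet's unit theorem in Mathlib's form
(`NumberField.Units.dirichletUnitTheorem.exists_unit`: a unit `ε` with `|ε|_w < 1` at every place
`w ≠ w₀`) provides a **Minkowski unit**: the real `G × G` matrix `(log |σε|_{τw₀})` is, after
deleting one row and column, strictly diagonally dominant (Gershgorin,
`det_ne_zero_of_sum_row_lt_diag`), so the conjugates `σε`, `σ ≠ 1`, are multiplicatively
independent modulo torsion:

* `exists_unit_forall_log_conj_lt_zero` — `ε` with `log |ρ ε|_{w₀} < 0` for all `ρ ≠ 1`;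
* `eq_zero_of_forall_sum_mul_log_conj_eq_zero` — if `n : G → ℤ`, `n 1 = 0`, and
  `∑_σ n_σ log |σε|_w = 0` at every infinite place `w`, then `n = 0`;
* `eq_zero_of_prod_conj_zpow_pow_eq_one` — multiplicative form: if `(∏_σ (σε)^{n_σ})^k = 1` with
  `k ≥ 1` and `n 1 = 0`, then `n = 0`.

This is the archimedean input of the Baker–Brumer proof of the `𝔭`-adic Leopoldt conjecture for
abelian `F/K` (Washington, Thm. 5.25 / Lemma 5.27 over `ℚ`; de Shalit 1987 III.2.3).

References: L. C. Washington, *Introduction to Cyclotomic Fields*, GTM 83, §5.5 (Lemma 5.27,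
Thm. 5.25); E. de Shalit, *Iwasawa theory of elliptic curves with complex multiplication* (1987),
III.2.3.
-/

noncomputable section

set_option linter.dupNamespace false -- `Summit.BirchSwinnertonDyer.BirchSwinnertonDyer` (summit = problem) is the tree's layout
set_option autoImplicit false

open NumberField NumberField.InfinitePlace Module
open Literature.NumberTheory.EllipticCurves

namespace Summit.BirchSwinnertonDyer.BirchSwinnertonDyer.Theorems.PrintCf2.LeopoldtAtV

variable {K : Type*} [Field K] {F : Type*} [Field F] [Algebra K F]

/-! ### §1. The Galois group acts simply transitively on the infinite places -/

/-- `(σ • w) (σ x) = w x` for the action of `Gal(F/K)` on the infinite places of `F`. [folklore] -/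
theorem smul_infinitePlace_apply_self (σ : F ≃ₐ[K] F) (w : InfinitePlace F) (x : F) :
    (σ • w) (σ x) = w x := by
  rw [InfinitePlace.smul_apply, AlgEquiv.symm_apply_apply]

/-- `w (σ x) = (σ⁻¹ • w) x`. [folklore] -/
theorem infinitePlace_apply_conj (σ : F ≃ₐ[K] F) (w : InfinitePlace F) (x : F) :
    w (σ x) = (σ⁻¹ • w) x := by
  rw [InfinitePlace.smul_apply, AlgEquiv.aut_inv, AlgEquiv.symm_symm]

variable [NumberField K] [NumberField F]

omit [NumberField F] in
/-- Over an imaginary quadratic base every infinite place of `F` is unramified (its restriction to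
`K` is the complex place of `K`). [folklore] -/
theorem isUnramified_infinitePlace (hK : IsImaginaryQuadratic K) (w : InfinitePlace F) :
    IsUnramified K w := by
  haveI : IsTotallyComplex K := IsImaginaryQuadratic.isTotallyComplex hK
  exact InfinitePlace.isUnramified_iff.mpr (Or.inr (IsTotallyComplex.isComplex _))

omit [NumberField F] in
/-- **`Gal(F/K)` acts simply transitively on the infinite places of `F`** when `K` is imaginary
quadratic and `F/K` is Galois: `σ ↦ σ • w₀` is a bijection. [folklore] -/
theorem smul_infinitePlace_bijective (hK : IsImaginaryQuadratic K) [IsGalois K F]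
    (w₀ : InfinitePlace F) : Function.Bijective (fun σ : F ≃ₐ[K] F ↦ σ • w₀) := by
  constructor
  · intro σ τ h
    change σ • w₀ = τ • w₀ at h
    have hstab := (isUnramified_infinitePlace hK w₀).stabilizer_eq_bot
    have hmem : τ⁻¹ * σ ∈ MulAction.stabilizer (F ≃ₐ[K] F) w₀ := by
      rw [MulAction.mem_stabilizer_iff, mul_smul, h, ← mul_smul, inv_mul_cancel, one_smul]
    rw [hstab, Subgroup.mem_bot] at hmem
    exact (eq_of_inv_mul_eq_one hmem).symm
  · intro w
    have hsub : Subsingleton (InfinitePlace K) := by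
      rw [← Fintype.card_le_one_iff_subsingleton, IsImaginaryQuadratic.card_infinitePlace_eq_one hK]
    exact InfinitePlace.exists_smul_eq_of_comap_eq (Subsingleton.elim _ _)

/-- The number of infinite places of `F` is `#Gal(F/K)` (`K` imaginary quadratic, `F/K` Galois).
[folklore] -/
theorem card_infinitePlace_eq_card_gal (hK : IsImaginaryQuadratic K) [IsGalois K F] :
    Fintype.card (InfinitePlace F) = Fintype.card (F ≃ₐ[K] F) := by
  obtain ⟨w₀⟩ := (inferInstance : Nonempty (InfinitePlace F))
  exact (Fintype.card_of_bijective (smul_infinitePlace_bijective hK w₀)).symm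

/-! ### §2. A Minkowski unit -/

/-- **A Minkowski unit**: there are a place `w₀` and a unit `ε ∈ 𝓞_Fˣ` with `log |ρ ε|_{w₀} < 0` for
every `ρ ≠ 1` in `Gal(F/K)` (`K` imaginary quadratic, `F/K` Galois) — Mathlib's Dirichlet unit
`|ε|_w < 1` for `w ≠ w₀`, read through the simply transitive action.
[cite: Washington1997, Lemma 5.27] -/
theorem exists_unit_forall_log_conj_lt_zero (hK : IsImaginaryQuadratic K) [IsGalois K F] :
    ∃ (w₀ : InfinitePlace F) (ε : (𝓞 F)ˣ), ∀ ρ : F ≃ₐ[K] F, ρ ≠ 1 →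
      Real.log (w₀ (ρ (algebraMap (𝓞 F) F (ε : 𝓞 F)))) < 0 := by
  obtain ⟨w₀⟩ := (inferInstance : Nonempty (InfinitePlace F))
  obtain ⟨ε, hε⟩ := NumberField.Units.dirichletUnitTheorem.exists_unit F w₀
  refine ⟨w₀, ε, fun ρ hρ ↦ ?_⟩
  rw [infinitePlace_apply_conj]
  refine hε _ fun h ↦ hρ ?_
  have hinj := (smul_infinitePlace_bijective hK w₀).1
  have h1 : ρ⁻¹ • w₀ = (1 : F ≃ₐ[K] F) • w₀ := by rw [h, one_smul]
  exact inv_eq_one.mp (hinj h1)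

/-- **Independence of the conjugates of a Minkowski unit (logarithmic form).** With `w₀`, `ε` as in
`exists_unit_forall_log_conj_lt_zero`: if `n : Gal(F/K) → ℤ` vanishes at `1` and
`∑_σ n_σ · log |σ ε|_w = 0` at every infinite place `w` of `F`, then `n = 0`. Proof: at `w = τ • w₀`
the relation reads `∑_σ n_σ a(τ⁻¹σ) = 0` with `a(ρ) = log |ρε|_{w₀}` (`a(1) > 0 > a(ρ)`, `ρ ≠ 1`,
`∑ a = 0`); the matrix `(a(τ⁻¹σ))_{τ,σ ≠ 1}` (bordered by a unit vector in the `σ = 1` column) is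
strictly row-diagonally dominant, hence invertible (Gershgorin). [cite: Washington1997, Lemma 5.27 and Thm. 5.25 (proof)] -/
theorem eq_zero_of_forall_sum_mul_log_conj_eq_zero (hK : IsImaginaryQuadratic K) [IsGalois K F]
    {w₀ : InfinitePlace F} {ε : (𝓞 F)ˣ}
    (hε : ∀ ρ : F ≃ₐ[K] F, ρ ≠ 1 → Real.log (w₀ (ρ (algebraMap (𝓞 F) F (ε : 𝓞 F)))) < 0)
    (n : (F ≃ₐ[K] F) → ℤ) (hn1 : n 1 = 0)
    (hrel : ∀ w : InfinitePlace F,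
      ∑ σ : F ≃ₐ[K] F, (n σ : ℝ) * Real.log (w (σ (algebraMap (𝓞 F) F (ε : 𝓞 F)))) = 0) :
    n = 0 := by
  classical
  set e : F := algebraMap (𝓞 F) F (ε : 𝓞 F) with he
  -- the function `a(ρ) = log |ρ ε|_{w₀}`
  set a : (F ≃ₐ[K] F) → ℝ := fun ρ ↦ Real.log (w₀ (ρ e)) with ha
  have ha_neg : ∀ ρ : F ≃ₐ[K] F, ρ ≠ 1 → a ρ < 0 := hε
  -- `∑_ρ a ρ = 0` (product formula, all places complex, places ↔ group elements)
  haveI : IsTotallyComplex K := IsImaginaryQuadratic.isTotallyComplex hK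
  haveI : IsTotallyComplex F := isTotallyComplex_of_algebra (F := K) F
  have hbij : Function.Bijective (fun ρ : F ≃ₐ[K] F ↦ ρ⁻¹ • w₀) :=
    (smul_infinitePlace_bijective hK w₀).comp inv_involutive.bijective
  have ha_sum : ∑ ρ : F ≃ₐ[K] F, a ρ = 0 := by
    have h := NumberField.Units.sum_mult_mul_log ε
    simp only [IsTotallyComplex.mult_eq, Nat.cast_ofNat] at h
    rw [← Finset.mul_sum, mul_eq_zero] at h
    have h' : ∑ w : InfinitePlace F, Real.log (w e) = 0 := h.resolve_left two_ne_zero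
    rw [← h']
    refine Fintype.sum_bijective _ hbij _ _ fun ρ ↦ ?_
    simp only [ha, infinitePlace_apply_conj ρ w₀ e]
  -- `a 1 = - ∑_{ρ ≠ 1} a ρ ≥ 0`
  have ha1 : a 1 = -∑ ρ ∈ Finset.univ.erase (1 : F ≃ₐ[K] F), a ρ := by
    have h := Finset.add_sum_erase Finset.univ a (Finset.mem_univ (1 : F ≃ₐ[K] F))
    linarith [ha_sum]
  have ha1_nonneg : 0 ≤ a 1 := by
    rw [ha1, neg_nonneg]
    exact Finset.sum_nonpos fun ρ hρ ↦ (ha_neg ρ (Finset.ne_of_mem_erase hρ)).le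
  -- the relation at `w = τ • w₀`: `∑_σ n σ * a (τ⁻¹ * σ) = 0`
  have hrel' : ∀ τ : F ≃ₐ[K] F, ∑ σ : F ≃ₐ[K] F, (n σ : ℝ) * a (τ⁻¹ * σ) = 0 := by
    intro τ
    have h := hrel (τ • w₀)
    simpa only [ha, AlgEquiv.mul_apply, InfinitePlace.smul_apply, AlgEquiv.aut_inv,
      AlgEquiv.symm_symm] using h
  -- the bordered convolution matrix
  set M : Matrix (F ≃ₐ[K] F) (F ≃ₐ[K] F) ℝ := fun τ σ ↦
    if σ = 1 then (if τ = 1 then a 1 + 1 else 0) else a (τ⁻¹ * σ) with hM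
  have hmul : M.mulVec (fun σ ↦ (n σ : ℝ)) = 0 := by
    funext τ
    rw [Matrix.mulVec, Pi.zero_apply]
    change ∑ σ, M τ σ * (n σ : ℝ) = 0
    rw [← hrel' τ]
    refine Finset.sum_congr rfl fun σ _ ↦ ?_
    by_cases hσ : σ = 1
    · subst hσ; simp [hn1]
    · simp only [hM, if_neg hσ, mul_comm]
  -- reindexing `σ ↦ τ⁻¹ * σ`
  have hsum_conj : ∀ τ : F ≃ₐ[K] F, ∑ σ : F ≃ₐ[K] F, a (τ⁻¹ * σ) = 0 := fun τ ↦ by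
    have h := Equiv.sum_comp (Equiv.mulLeft τ⁻¹) a
    simp only [Equiv.coe_mulLeft] at h
    rw [h, ha_sum]
  -- Gershgorin: strict row dominance
  have hdet : M.det ≠ 0 := by
    refine det_ne_zero_of_sum_row_lt_diag fun τ ↦ ?_
    by_cases hτ : τ = 1
    · -- row `1`: diagonal `a 1 + 1`, off-diagonal entries `a σ`, `σ ≠ 1`, of total norm `a 1`
      subst hτ
      have hM11 : M 1 1 = a 1 + 1 := by simp [hM]
      have hdiag : ‖M 1 1‖ = a 1 + 1 := by
        rw [hM11, Real.norm_eq_abs]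
        exact abs_of_pos (by linarith)
      have hoff : ∑ σ ∈ Finset.univ.erase (1 : F ≃ₐ[K] F), ‖M 1 σ‖ =
          -∑ σ ∈ Finset.univ.erase (1 : F ≃ₐ[K] F), a σ := by
        rw [← Finset.sum_neg_distrib]
        refine Finset.sum_congr rfl fun σ hσ ↦ ?_
        have hσ1 : σ ≠ 1 := Finset.ne_of_mem_erase hσ
        simp only [hM, if_neg hσ1, inv_one, one_mul, Real.norm_eq_abs]
        exact abs_of_neg (ha_neg σ hσ1)
      rw [hoff, hdiag, ← ha1]
      linarith
    · -- row `τ ≠ 1`: diagonal `a 1`, off-diagonal total `a 1 + a τ⁻¹ < a 1`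
      have hτinv : τ⁻¹ ≠ 1 := fun h ↦ hτ (inv_eq_one.mp h)
      have hdiag : ‖M τ τ‖ = a 1 := by
        simp only [hM, if_neg hτ, inv_mul_cancel, Real.norm_eq_abs]
        exact abs_of_nonneg ha1_nonneg
      -- entries of row `τ` off the diagonal: `g σ := if σ = 1 then 0 else -a (τ⁻¹ * σ)`
      have hoff : ∑ σ ∈ Finset.univ.erase τ, ‖M τ σ‖ =
          ∑ σ ∈ Finset.univ.erase τ, (if σ = 1 then (0 : ℝ) else -a (τ⁻¹ * σ)) := by
        refine Finset.sum_congr rfl fun σ hσ ↦ ?_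
        have hστ : σ ≠ τ := Finset.ne_of_mem_erase hσ
        by_cases hσ1 : σ = 1
        · subst hσ1; simp [hM, hτ]
        · simp only [hM, if_neg hσ1, Real.norm_eq_abs]
          refine abs_of_neg (ha_neg _ fun h ↦ hστ ?_)
          exact (eq_of_inv_mul_eq_one h).symm
      have hfull : ∑ σ : F ≃ₐ[K] F, (if σ = 1 then (0 : ℝ) else -a (τ⁻¹ * σ)) = a τ⁻¹ := by
        have hsplit := Finset.add_sum_erase Finset.univ
          (fun σ : F ≃ₐ[K] F ↦ (if σ = 1 then (0 : ℝ) else -a (τ⁻¹ * σ))) (Finset.mem_univ 1)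
        have herase1 : ∑ σ ∈ Finset.univ.erase (1 : F ≃ₐ[K] F),
            (if σ = 1 then (0 : ℝ) else -a (τ⁻¹ * σ)) =
            ∑ σ ∈ Finset.univ.erase (1 : F ≃ₐ[K] F), -a (τ⁻¹ * σ) :=
          Finset.sum_congr rfl fun σ hσ ↦ if_neg (Finset.ne_of_mem_erase hσ)
        have hsplit2 := Finset.add_sum_erase Finset.univ
          (fun σ : F ≃ₐ[K] F ↦ -a (τ⁻¹ * σ)) (Finset.mem_univ 1)
        have hneg : ∑ σ : F ≃ₐ[K] F, -a (τ⁻¹ * σ) = 0 := by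
          rw [Finset.sum_neg_distrib, hsum_conj τ, neg_zero]
        simp only [if_true, zero_add, mul_one] at hsplit hsplit2
        rw [← hsplit, herase1]
        linarith
      have herase := Finset.sum_erase_eq_sub (f := fun σ : F ≃ₐ[K] F ↦
        (if σ = 1 then (0 : ℝ) else -a (τ⁻¹ * σ))) (Finset.mem_univ τ)
      rw [hoff, herase, hfull, hdiag, if_neg hτ, inv_mul_cancel]
      linarith [ha_neg τ⁻¹ hτinv]
  -- conclusion
  have hzero := Matrix.eq_zero_of_mulVec_eq_zero hdet hmul
  funext σ
  have := congr_fun hzero σ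
  simpa using this

/-- **Independence of the conjugates of a Minkowski unit (multiplicative form).** With `w₀`, `ε` as
in `exists_unit_forall_log_conj_lt_zero`: if `n : Gal(F/K) → ℤ` vanishes at `1` and
`(∏_σ (σε)^{n σ})^k = 1` in `F` for some `k ≥ 1`, then `n = 0` — the conjugates `σε`, `σ ≠ 1`, are
multiplicatively independent modulo roots of unity. [cite: Washington1997, Lemma 5.27] -/
theorem eq_zero_of_prod_conj_zpow_pow_eq_one (hK : IsImaginaryQuadratic K) [IsGalois K F]
    {w₀ : InfinitePlace F} {ε : (𝓞 F)ˣ}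
    (hε : ∀ ρ : F ≃ₐ[K] F, ρ ≠ 1 → Real.log (w₀ (ρ (algebraMap (𝓞 F) F (ε : 𝓞 F)))) < 0)
    (n : (F ≃ₐ[K] F) → ℤ) (hn1 : n 1 = 0) {k : ℕ} (hk : 0 < k)
    (hprod : (∏ σ : F ≃ₐ[K] F, (σ (algebraMap (𝓞 F) F (ε : 𝓞 F))) ^ (n σ)) ^ k = 1) :
    n = 0 := by
  refine eq_zero_of_forall_sum_mul_log_conj_eq_zero hK hε n hn1 fun w ↦ ?_
  have he0 : algebraMap (𝓞 F) F (ε : 𝓞 F) ≠ 0 := by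
    rw [Ne, map_eq_zero_iff _ (IsFractionRing.injective (𝓞 F) F)]
    exact (ε.ne_zero)
  have hσe : ∀ σ : F ≃ₐ[K] F, 0 < w (σ (algebraMap (𝓞 F) F (ε : 𝓞 F))) := fun σ ↦
    InfinitePlace.pos_iff.mpr ((map_ne_zero σ).mpr he0)
  -- apply the place `w` to the multiplicative relation
  have h1 : w (∏ σ : F ≃ₐ[K] F, (σ (algebraMap (𝓞 F) F (ε : 𝓞 F))) ^ (n σ)) = 1 := by
    have h := congrArg w hprod
    rw [map_pow, map_one] at h
    exact (pow_eq_one_iff_of_nonneg (apply_nonneg _ _) hk.ne').mp h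
  rw [map_prod] at h1
  have h2 := congrArg Real.log h1
  rw [Real.log_one, Real.log_prod] at h2
  · rw [← h2]
    refine Finset.sum_congr rfl fun σ _ ↦ ?_
    rw [map_zpow₀, Real.log_zpow]
  · intro σ _
    rw [map_zpow₀]
    exact zpow_ne_zero _ (hσe σ).ne'

end Summit.BirchSwinnertonDyer.BirchSwinnertonDyer.Theorems.PrintCf2.LeopoldtAtV

end
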